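import Summits.QuantumFields.BalabanUV.Beta.GAN24.CurrentSymSectorSplit
import Summits.QuantumFields.BalabanUV.Beta.GAN24.CubicSectorCurrentSym
import Summits.QuantumFields.BalabanUV.Beta.GAN24.VHClassCurrentSym
import Summits.QuantumFields.BalabanUV.Beta.GAN24.WilsonCurrentSym
import Summits.QuantumFields.BalabanUV.Beta.SpineRecursiveParity
import Summits.QuantumFields.BalabanUV.Beta.GAN24.RespWordsLevelZero

/-!
# `BalabanUV.Beta.GAN24.CurrentSymTower` — binder row G-an2-4 ∕ (CONV-C), W-slot CT-W, conservation law (C)∕(C)sym AT ALL LEVELS, THE (A)-TOWER ASSEMBLED (note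
# `HOME/b2b-balaban-gan24-formalise-leaf-04/g68/EXIT-FACE-CURRENT-TOWER.md` §2 (I6)): **FOR EVERY `j`, EVERY IN-BLOCK ROOT, ALL `cE cVH cΛ`, ALL FACE-SUPPORTED CLASS DATA AND EVERY FREE
# LEG `(p, a)`, THE SLOT↔LEG-SYMMETRISED TWO-LEG CURRENT OF `SrecAt j` — AND OF THE PURE TABLE `SpureRecAt j` — VANISHES**; in the free-leg-first placement with units, the symmetrised
# exit-face source of `unitS s_f s_m (SpureRecAt j)` vanishes at every first leg (the level-`j` input of 39 `RespChargeSym` ∕ 40 `RespWordsLevelZero`, there proved at `j = 0` only on field legs).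

ONE MODULE, TWO PARTS (leaf-04 gen 70, 2026-08-23): Part A = gen 69's staged F5 `CurrentSymTower` (THE (A)-TOWER, namespace `…GAN24.CurrentSymTower`) and Part B = gen 69's staged F6
`RespWordsAllLevels` ((L3c)_j, namespace `…GAN24.RespWordsAllLevels`: `respCharge_add_swap_eq_zero`, `respWords_add_swap_eq_zero`; never filed as a separate module), each a complete
`noncomputable section`, bytes of both bodies UNCHANGED from the twins certified together by gen 69's concat cert `Concat_F6_18body` (rc 0, 0 sorry); merged only to shorten the gate's olean chain.

NOT IN PRINT; OUR BOOKKEEPING ([folklore] `Nat.rec` over this gen's `CurrentSymSectorSplit.sym_SrecAt_succ_of_sectors ∕ sym_S0NAt_of_sectors`, `CubicSectorCurrentSym.sym_e3OfK_of_sym`,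
`VHClassCurrentSym.vhSAt_classCurrent_add_swap_eq_zero`, `WilsonCurrentSym.sym_wilsonA`, leaf-10∕an2's `WardLocusRecursive.locStencil_SrecAt`, `SpineRecursiveW.SpureRecAt_zero_level ∕ _succ`,
`SpineRecursiveParity.trK_pureZero ∕ trK_pureSucc`, `HessKerDressedUnits.unitS_apply`; G-an2-4 formalisation swarm, leaf prover `b2b-balaban-gan24-formalise-leaf-04`, gen 69).  HONEST FRAMING
(cell contract, verbatim): «discharging `BetaPertH` makes Bałaban's UV stability UNCONDITIONAL — a real constructive-QFT result; it is NOT the continuum limit and NOT the Clay problem.»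
HONEST DEPENDENCY (verbatim): «continuum YM on T⁴ ⇐ BetaPertH ∧ nine spine estimates (0/9 proved); BetaPertH ⇐ (D1) ∧ (D4) ∧ CAP+tail; G-an2-4 gates asym, D1 and NE2/3/4.»

WHAT ([folklore]; generic `d`, `[NeZero Lc]`, in-block root `r ∈ box Lc`, all `cE cVH cΛ`; 0 `def`, 0 cited facts, 0 `def … : Prop`, 0 sorry): §1 **`sym_SrecAt_all`** (the tower: every `j`,
all `ν β`, all face-supported class data `c + dΨ` (bounded `Ψ`, zero off the exit faces), all free legs); §2 `classCurrent_add_smul_eq` (two-sector split), **`sym_SpureRecAt`** (every `j`);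
§3 `parityOdd_SpureRecAt`, **`faceSource_unitS_SpureRecAt_add_swap_eq_zero`** (free leg FIRST, units `s_f s_m`, face indicators and the constant `K` of 39: for every first leg `(s, f)`,
`Σ'_{s′} 𝟙f(s′_ν)·K·Σ'_{t′} 𝟙f(t′_μ)·unitS s_f s_m (SpureRecAt j) μ t′ s s′ f (inl ν) + (μ ↔ ν) = 0`).  Asserts NO value of Bałaban's tables; discharges NOTHING of (C)sym ∕ (Q-D) ∕ (Q-D-rate) ∕
«T2Shape» ∕ «T2Drift» ∕ (hW, hWall); NEVER «G-an2-4 closed» as (CONV-C); NOT D1, NOT `BetaPertH`, NOT continuum, NOT Clay.  2026-08-23; no existing file touched.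
-/

/-!
# Part A — namespace `…GAN24.CurrentSymTower`
-/

noncomputable section

open Finset
open scoped BigOperators
open Literature.MathematicalPhysics.QuantumFieldTheory
open Literature.MathematicalPhysics.QuantumFieldTheory.Balaban1983to89
open Literature.MathematicalPhysics.QuantumFieldTheory.Balaban1983to89.Beta
open ExpKernelCalculus (Site MKer)
open AffineAveraging (box toSite)
open OneStepResolventKernel (Fib LocStencil)
open OneStepKernelFamily (KInvStep)
open StepJetData (wilsonA locStencil_wilsonA)
open BalabanStepJetsSucc (wE wVH)
open AveragingHessianKernelsRooted (vhSAt locStencil_vhSAt)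
open Summit.QuantumFields.BalabanUV.Beta.TameKernelCalculus (trK trK_apply)
open Summit.QuantumFields.BalabanUV.Beta.BorderedHessian (sgnK sgnK_apply sgnF sgnF_inl)
open Summit.QuantumFields.BalabanUV.Beta.HessKerDressedUnits (unitS unitS_apply legScale legScale_inl)
open Summit.QuantumFields.BalabanUV.Beta.AxialDressingRooted (coDressKBmAt)
open Summit.QuantumFields.BalabanUV.Beta.SpineRooted (e3OfK SpureRecAt SpureRecAt_zero_level SpureRecAt_succ)
open Summit.QuantumFields.BalabanUV.Beta.WardLocusRecursive (SrecAt SrecAt_zero locStencil_SrecAt)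
open Summit.QuantumFields.BalabanUV.Beta.SpineRecursiveParity (trK_pureZero trK_pureSucc)
open Summit.QuantumFields.BalabanUV.Beta.GAN24.ExitFaceCurrentSectorSplit (exists_locStencil_eSector)
open Summit.QuantumFields.BalabanUV.Beta.GAN24.ExitFaceCurrentSectorSplit (summable_slot_locStencil)
open Summit.QuantumFields.BalabanUV.Beta.GAN24.CurrentSymSectorSplit (summable_leg_slot_fst abs_classDatum_le sym_SrecAt_succ_of_sectors sym_S0NAt_of_sectors)
open Summit.QuantumFields.BalabanUV.Beta.GAN24.CubicSectorCurrentSym (sym_e3OfK_of_sym)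
open Summit.QuantumFields.BalabanUV.Beta.GAN24.VHClassCurrentSym (vhSAt_classCurrent_add_swap_eq_zero)
open Summit.QuantumFields.BalabanUV.Beta.GAN24.WilsonCurrentSym (sym_wilsonA)

namespace Summit.QuantumFields.BalabanUV.Beta.GAN24.CurrentSymTower

variable {d : ℕ} {Lc : ℕ} [NeZero Lc] {r : Fin (d + 1) → ℕ}

/-! ## §1 The tower -/

/-- [folklore] **THE (A)-TOWER**: for every `j`, all directions `ν β`, all face-supported class data `c₁ + dΨ₁` (leg), `c₂ + dΨ₂` (slot) with bounded `Ψ`'s, and every free leg `(p, a)`,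
`Σ'_q (c₁ + dΨ₁(q_β))·Σ'_u (c₂ + dΨ₂(u_ν))·SrecAt j ν u q p (inl β) a + Σ'_q (c₂ + dΨ₂(q_ν))·Σ'_u (c₁ + dΨ₁(u_β))·SrecAt j β u q p (inl ν) a = 0`. -/
theorem sym_SrecAt_all (hr : r ∈ box (d + 1) Lc) (cE cVH cΛ : ℝ) :
    ∀ (j : ℕ) (ν β : Fin (d + 1)) (c₁ : ℝ) (Ψ₁ : ℤ → ℝ) (B₁ : ℝ), (∀ s, |Ψ₁ s| ≤ B₁) → (∀ n : ℤ, n % (Lc : ℤ) ≠ (Lc : ℤ) - 1 → c₁ + (Ψ₁ (n + 1) - Ψ₁ n) = 0) →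
      ∀ (c₂ : ℝ) (Ψ₂ : ℤ → ℝ) (B₂ : ℝ), (∀ s, |Ψ₂ s| ≤ B₂) → (∀ n : ℤ, n % (Lc : ℤ) ≠ (Lc : ℤ) - 1 → c₂ + (Ψ₂ (n + 1) - Ψ₂ n) = 0) →
      ∀ (p : Site (d + 1)) (a : Fib d),
        (∑' q : Site (d + 1), (c₁ + (Ψ₁ (q β + 1) - Ψ₁ (q β))) * ∑' u : Site (d + 1), (c₂ + (Ψ₂ (u ν + 1) - Ψ₂ (u ν))) * SrecAt d Lc (toSite r) cE cVH cΛ j ν u q p (Sum.inl β) a) +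
          ∑' q : Site (d + 1), (c₂ + (Ψ₂ (q ν + 1) - Ψ₂ (q ν))) * ∑' u : Site (d + 1), (c₁ + (Ψ₁ (u β + 1) - Ψ₁ (u β))) * SrecAt d Lc (toSite r) cE cVH cΛ j β u q p (Sum.inl ν) a = 0 := by
  have hLc : 1 ≤ Lc := Nat.one_le_iff_ne_zero.mpr (NeZero.ne Lc)
  intro j
  induction j with
  | zero =>
    intro ν β c₁ Ψ₁ B₁ hΨ₁ hf₁ c₂ Ψ₂ B₂ hΨ₂ hf₂ p a
    simp only [SrecAt_zero]
    exact sym_S0NAt_of_sectors hr cE cVH cΛ ν β c₁ Ψ₁ hΨ₁ c₂ Ψ₂ hΨ₂ p a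
      (sym_wilsonA ν β (fun n => c₂ + (Ψ₂ (n + 1) - Ψ₂ n)) (fun n => c₁ + (Ψ₁ (n + 1) - Ψ₁ n)) p a)
      (vhSAt_classCurrent_add_swap_eq_zero hLc hr ν β (h := fun n => c₁ + (Ψ₁ (n + 1) - Ψ₁ n)) (s := fun n => c₂ + (Ψ₂ (n + 1) - Ψ₂ n)) hf₁ hf₂ p a)
  | succ j ih =>
    intro ν β c₁ Ψ₁ B₁ hΨ₁ hf₁ c₂ Ψ₂ B₂ hΨ₂ hf₂ p a
    obtain ⟨Cs, δs, hδs, hS⟩ := locStencil_SrecAt (d := d) hLc hr cE cVH cΛ j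
    exact sym_SrecAt_succ_of_sectors hr cE cVH cΛ j ν β c₁ Ψ₁ hΨ₁ c₂ Ψ₂ hΨ₂ p a
      (sym_e3OfK_of_sym hr j hS hδs ν β (fun c₁' Ψ₁' B₁' h₁ f₁ c₂' Ψ₂' B₂' h₂ f₂ p' a' => ih ν β c₁' Ψ₁' B₁' h₁ f₁ c₂' Ψ₂' B₂' h₂ f₂ p' a') c₁ Ψ₁ hΨ₁ c₂ Ψ₂ hΨ₂ p a)
      (vhSAt_classCurrent_add_swap_eq_zero hLc hr ν β (h := fun n => c₁ + (Ψ₁ (n + 1) - Ψ₁ n)) (s := fun n => c₂ + (Ψ₂ (n + 1) - Ψ₂ n)) hf₁ hf₂ p a)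

/-! ## §2 The pure table `SpureRecAt j` -/

omit [NeZero Lc] in
/-- [folklore] **TWO-SECTOR SPLIT** of the class-weighted current (weighted leg first, any free leg) of `T = c₁ • T₁ + c₂ • T₂`, both local stencil families. -/
theorem classCurrent_add_smul_eq {T₁ T₂ : Fin (d + 1) → Site (d + 1) → MKer (d + 1) (Fib d)} {C₁ δ₁ C₂ δ₂ : ℝ} (h1 : LocStencil T₁ C₁ δ₁) (hδ₁ : 0 < δ₁)
    (h2 : LocStencil T₂ C₂ δ₂) (hδ₂ : 0 < δ₂) (c₁ c₂ : ℝ) (ν β : Fin (d + 1))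
    {h : Site (d + 1) → ℝ} {Bh : ℝ} (hh : ∀ q, |h q| ≤ Bh) {s : Site (d + 1) → ℝ} {Bs : ℝ} (hs : ∀ u, |s u| ≤ Bs) (p : Site (d + 1)) (a : Fib d) :
    ∑' q : Site (d + 1), h q * ∑' u : Site (d + 1), s u * (c₁ • T₁ ν u + c₂ • T₂ ν u) q p (Sum.inl β) a =
      c₁ * ∑' q : Site (d + 1), h q * ∑' u : Site (d + 1), s u * T₁ ν u q p (Sum.inl β) a
        + c₂ * ∑' q : Site (d + 1), h q * ∑' u : Site (d + 1), s u * T₂ ν u q p (Sum.inl β) a := by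
  have einner : ∀ q : Site (d + 1), ∑' u : Site (d + 1), s u * (c₁ • T₁ ν u + c₂ • T₂ ν u) q p (Sum.inl β) a =
      c₁ * ∑' u : Site (d + 1), s u * T₁ ν u q p (Sum.inl β) a + c₂ * ∑' u : Site (d + 1), s u * T₂ ν u q p (Sum.inl β) a := by
    intro q
    have e : ∀ u : Site (d + 1), s u * (c₁ • T₁ ν u + c₂ • T₂ ν u) q p (Sum.inl β) a =
        c₁ * (s u * T₁ ν u q p (Sum.inl β) a) + c₂ * (s u * T₂ ν u q p (Sum.inl β) a) := by
      intro u; simp only [Pi.add_apply, Pi.smul_apply, smul_eq_mul]; ring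
    rw [tsum_congr e, ((summable_slot_locStencil h1 hδ₁ hs ν q p _ _).mul_left _).tsum_add ((summable_slot_locStencil h2 hδ₂ hs ν q p _ _).mul_left _), tsum_mul_left, tsum_mul_left]
  have e : ∀ q : Site (d + 1), h q * ∑' u : Site (d + 1), s u * (c₁ • T₁ ν u + c₂ • T₂ ν u) q p (Sum.inl β) a =
      c₁ * (h q * ∑' u : Site (d + 1), s u * T₁ ν u q p (Sum.inl β) a) + c₂ * (h q * ∑' u : Site (d + 1), s u * T₂ ν u q p (Sum.inl β) a) := by
    intro q; rw [einner q]; ring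
  rw [tsum_congr e, ((summable_leg_slot_fst h1 hδ₁ hh hs ν p _ _).mul_left _).tsum_add ((summable_leg_slot_fst h2 hδ₂ hh hs ν p _ _).mul_left _), tsum_mul_left, tsum_mul_left]

/-- [folklore] **THE (A)-TOWER FOR THE PURE TABLE `SpureRecAt j`** (every `j`: cubic∕Wilson sector by the tower one level down, border sector by the VH letter). -/
theorem sym_SpureRecAt (hr : r ∈ box (d + 1) Lc) (cE cVH cΛ : ℝ) (j : ℕ) (ν β : Fin (d + 1))
    (c₁ : ℝ) (Ψ₁ : ℤ → ℝ) {B₁ : ℝ} (hΨ₁ : ∀ s, |Ψ₁ s| ≤ B₁) (hf₁ : ∀ n : ℤ, n % (Lc : ℤ) ≠ (Lc : ℤ) - 1 → c₁ + (Ψ₁ (n + 1) - Ψ₁ n) = 0)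
    (c₂ : ℝ) (Ψ₂ : ℤ → ℝ) {B₂ : ℝ} (hΨ₂ : ∀ s, |Ψ₂ s| ≤ B₂) (hf₂ : ∀ n : ℤ, n % (Lc : ℤ) ≠ (Lc : ℤ) - 1 → c₂ + (Ψ₂ (n + 1) - Ψ₂ n) = 0)
    (p : Site (d + 1)) (a : Fib d) :
    (∑' q : Site (d + 1), (c₁ + (Ψ₁ (q β + 1) - Ψ₁ (q β))) * ∑' u : Site (d + 1), (c₂ + (Ψ₂ (u ν + 1) - Ψ₂ (u ν))) * SpureRecAt d Lc (toSite r) cE cVH cΛ j ν u q p (Sum.inl β) a) +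
      ∑' q : Site (d + 1), (c₂ + (Ψ₂ (q ν + 1) - Ψ₂ (q ν))) * ∑' u : Site (d + 1), (c₁ + (Ψ₁ (u β + 1) - Ψ₁ (u β))) * SpureRecAt d Lc (toSite r) cE cVH cΛ j β u q p (Sum.inl ν) a = 0 := by
  have hLc : 1 ≤ Lc := Nat.one_le_iff_ne_zero.mpr (NeZero.ne Lc)
  have hb₁ : ∀ q : Site (d + 1), |c₁ + (Ψ₁ (q β + 1) - Ψ₁ (q β))| ≤ |c₁| + (B₁ + B₁) := fun q => abs_classDatum_le c₁ Ψ₁ hΨ₁ (q β)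
  have hb₁' : ∀ u : Site (d + 1), |c₁ + (Ψ₁ (u β + 1) - Ψ₁ (u β))| ≤ |c₁| + (B₁ + B₁) := fun u => abs_classDatum_le c₁ Ψ₁ hΨ₁ (u β)
  have hb₂ : ∀ u : Site (d + 1), |c₂ + (Ψ₂ (u ν + 1) - Ψ₂ (u ν))| ≤ |c₂| + (B₂ + B₂) := fun u => abs_classDatum_le c₂ Ψ₂ hΨ₂ (u ν)
  have hb₂' : ∀ q : Site (d + 1), |c₂ + (Ψ₂ (q ν + 1) - Ψ₂ (q ν))| ≤ |c₂| + (B₂ + B₂) := fun q => abs_classDatum_le c₂ Ψ₂ hΨ₂ (q ν)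
  have hVH := vhSAt_classCurrent_add_swap_eq_zero hLc hr ν β (h := fun n => c₁ + (Ψ₁ (n + 1) - Ψ₁ n)) (s := fun n => c₂ + (Ψ₂ (n + 1) - Ψ₂ n)) hf₁ hf₂ p a
  have h2 := locStencil_vhSAt (d := d) hLc hr (zero_le_one)
  have e : ∀ (x y A B A' B' : ℝ), (x * A + y * B) + (x * A' + y * B') = x * (A + A') + y * (B + B') := by intros; ring
  cases j with
  | zero =>
    have h1 := locStencil_wilsonA (d := d) zero_le_one
    have hW := sym_wilsonA ν β (fun n => c₂ + (Ψ₂ (n + 1) - Ψ₂ n)) (fun n => c₁ + (Ψ₁ (n + 1) - Ψ₁ n)) p a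
    simp only [SpureRecAt_zero_level]
    rw [classCurrent_add_smul_eq h1 one_pos h2 one_pos cE cVH ν β hb₁ hb₂ p a, classCurrent_add_smul_eq h1 one_pos h2 one_pos cE cVH β ν hb₂' hb₁' p a, e, hW, hVH,
      mul_zero, mul_zero, add_zero]
  | succ j =>
    obtain ⟨C₁, δ₁, hδ₁, h1⟩ := exists_locStencil_eSector (d := d) hr cE cVH cΛ j
    obtain ⟨Cs, δs, hδs, hS⟩ := locStencil_SrecAt (d := d) hLc hr cE cVH cΛ j
    have hE := sym_e3OfK_of_sym hr j hS hδs ν β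
      (fun c₁' Ψ₁' B₁' h₁ f₁ c₂' Ψ₂' B₂' h₂ f₂ p' a' => sym_SrecAt_all hr cE cVH cΛ j ν β c₁' Ψ₁' B₁' h₁ f₁ c₂' Ψ₂' B₂' h₂ f₂ p' a') c₁ Ψ₁ hΨ₁ c₂ Ψ₂ hΨ₂ p a
    simp only [SpureRecAt_succ]
    rw [classCurrent_add_smul_eq h1 hδ₁ h2 one_pos _ _ ν β hb₁ hb₂ p a, classCurrent_add_smul_eq h1 hδ₁ h2 one_pos _ _ β ν hb₂' hb₁' p a, e, hE, hVH,
      mul_zero, mul_zero, add_zero]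

/-! ## §3 Free leg first, units: the symmetrised exit-face source of `unitS s_f s_m (SpureRecAt j)` -/

/-- [folklore] The rows of `SpureRecAt j` are parity-odd (`SpineRecursiveParity.trK_pureZero ∕ trK_pureSucc`). -/
theorem parityOdd_SpureRecAt (hr : r ∈ box (d + 1) Lc) (cE cVH cΛ : ℝ) (j : ℕ) (κ : Fin (d + 1)) (u : Site (d + 1)) :
    trK (SpureRecAt d Lc (toSite r) cE cVH cΛ j κ u) = -sgnK (SpureRecAt d Lc (toSite r) cE cVH cΛ j κ u) := by
  have hLc : 1 ≤ Lc := Nat.one_le_iff_ne_zero.mpr (NeZero.ne Lc)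
  cases j with
  | zero => rw [SpureRecAt_zero_level]; exact trK_pureZero (toSite r) cE cVH κ u
  | succ j => rw [SpureRecAt_succ]; exact trK_pureSucc hLc hr cE cVH cΛ j κ u

/-- [folklore] **THE SYMMETRISED EXIT-FACE SOURCE OF `unitS s_f s_m (SpureRecAt j)` VANISHES AT EVERY FIRST LEG** (free leg FIRST; the level-`j` input of 39∕40, there typed at `j = 0` on field
legs only): for every `(s, f)` and every constant `K`,
`Σ'_{s′} [s′_ν face]·K·Σ'_{t′} [t′_μ face]·unitS s_f s_m (SpureRecAt j) μ t′ s s′ f (inl ν) + Σ'_{s′} [s′_μ face]·K·Σ'_{t′} [t′_ν face]·unitS s_f s_m (SpureRecAt j) ν t′ s s′ f (inl μ) = 0`. -/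
theorem faceSource_unitS_SpureRecAt_add_swap_eq_zero (hr : r ∈ box (d + 1) Lc) (sf sm cE cVH cΛ K : ℝ) (j : ℕ) (μ ν : Fin (d + 1)) (s : Site (d + 1)) (f : Fib d) :
    (∑' s' : Site (d + 1), (if s' ν % (Lc : ℤ) = (Lc : ℤ) - 1 then
        K * ∑' t' : Site (d + 1), (if t' μ % (Lc : ℤ) = (Lc : ℤ) - 1 then unitS sf sm (SpureRecAt d Lc (toSite r) cE cVH cΛ j) μ t' s s' f (Sum.inl ν) else 0) else 0)) +
      ∑' s' : Site (d + 1), (if s' μ % (Lc : ℤ) = (Lc : ℤ) - 1 then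
        K * ∑' t' : Site (d + 1), (if t' ν % (Lc : ℤ) = (Lc : ℤ) - 1 then unitS sf sm (SpureRecAt d Lc (toSite r) cE cVH cΛ j) ν t' s s' f (Sum.inl μ) else 0) else 0) = 0 := by
  have hLc : 1 ≤ Lc := Nat.one_le_iff_ne_zero.mpr (NeZero.ne Lc)
  have hL0 : (Lc : ℝ) ≠ 0 := by exact_mod_cast NeZero.ne Lc
  -- the face indicator is a face-supported class datum: `𝟙[n ≡ −1] = Lc⁻¹ + (Φ(n+1) − Φ(n))`, `Φ(n) = −Lc⁻¹·(n mod Lc)`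
  set Φ : ℤ → ℝ := fun n => -((Lc : ℝ)⁻¹) * (((n % (Lc : ℤ) : ℤ) : ℝ)) with hΦ
  have hface : ∀ n : ℤ, (if n % (Lc : ℤ) = (Lc : ℤ) - 1 then (1 : ℝ) else 0) = (Lc : ℝ)⁻¹ + (Φ (n + 1) - Φ n) := by
    intro n
    have hs := FaceDatumMultiplierResponse.sawtooth_step (Lc := Lc) hLc n
    have e : (Lc : ℝ)⁻¹ + (Φ (n + 1) - Φ n) = (Lc : ℝ)⁻¹ * (1 - (((((n + 1) % (Lc : ℤ) : ℤ) : ℝ)) - (((n % (Lc : ℤ) : ℤ) : ℝ)))) := by simp only [hΦ]; ring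
    rw [e, hs]
    field_simp
    ring
  have hΦb : ∀ n, |Φ n| ≤ 1 := by
    intro n
    have hL : (0 : ℤ) < Lc := by exact_mod_cast hLc
    have hLr : (0 : ℝ) < Lc := by exact_mod_cast hL
    have hm0 : (0 : ℝ) ≤ (((n % (Lc : ℤ) : ℤ) : ℝ)) := by exact_mod_cast Int.emod_nonneg _ hL.ne'
    have hm1 : (((n % (Lc : ℤ) : ℤ) : ℝ)) ≤ (Lc : ℝ) := by exact_mod_cast (Int.emod_lt_of_pos n hL).le
    simp only [hΦ]
    rw [abs_mul, abs_neg, abs_inv, abs_of_pos hLr, abs_of_nonneg hm0]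
    calc (Lc : ℝ)⁻¹ * (((n % (Lc : ℤ) : ℤ) : ℝ)) ≤ (Lc : ℝ)⁻¹ * (Lc : ℝ) := mul_le_mul_of_nonneg_left hm1 (by positivity)
      _ = 1 := by field_simp
  have hff : ∀ n : ℤ, n % (Lc : ℤ) ≠ (Lc : ℤ) - 1 → (Lc : ℝ)⁻¹ + (Φ (n + 1) - Φ n) = 0 := fun n hn => by rw [← hface n, if_neg hn]
  -- the tower for the pure table, weighted leg first, free leg `(s, f)` second
  have hT := sym_SpureRecAt hr cE cVH cΛ j μ ν ((Lc : ℝ)⁻¹) Φ hΦb hff ((Lc : ℝ)⁻¹) Φ hΦb hff s f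
  -- move to the free-leg-first placement with units: every entry picks up the same factor `−(sf·sm)⁻¹·ℓ(f)·sf⁻¹·sgnF f`
  have hpar := parityOdd_SpureRecAt hr cE cVH cΛ j
  have eentry : ∀ (κ τ : Fin (d + 1)) (t' s' : Site (d + 1)), unitS sf sm (SpureRecAt d Lc (toSite r) cE cVH cΛ j) κ t' s s' f (Sum.inl τ) =
      (-((sf * sm)⁻¹ * legScale sf⁻¹ sm⁻¹ f * sf⁻¹ * sgnF f)) * SpureRecAt d Lc (toSite r) cE cVH cΛ j κ t' s' s (Sum.inl τ) f := by
    intro κ τ t' s'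
    rw [unitS_apply, legScale_inl]
    have h := congrFun (congrFun (congrFun (congrFun (hpar κ t') s') s) (Sum.inl τ)) f
    rw [trK_apply] at h
    rw [h]
    simp only [Pi.neg_apply, sgnK_apply, sgnF_inl, one_mul]
    ring
  have eterm : ∀ (κ τ : Fin (d + 1)), (∑' s' : Site (d + 1), (if s' τ % (Lc : ℤ) = (Lc : ℤ) - 1 then
        K * ∑' t' : Site (d + 1), (if t' κ % (Lc : ℤ) = (Lc : ℤ) - 1 then unitS sf sm (SpureRecAt d Lc (toSite r) cE cVH cΛ j) κ t' s s' f (Sum.inl τ) else 0) else 0)) =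
      (K * -((sf * sm)⁻¹ * legScale sf⁻¹ sm⁻¹ f * sf⁻¹ * sgnF f)) *
        ∑' s' : Site (d + 1), ((Lc : ℝ)⁻¹ + (Φ (s' τ + 1) - Φ (s' τ))) * ∑' t' : Site (d + 1), ((Lc : ℝ)⁻¹ + (Φ (t' κ + 1) - Φ (t' κ))) *
          SpureRecAt d Lc (toSite r) cE cVH cΛ j κ t' s' s (Sum.inl τ) f := by
    intro κ τ
    rw [← tsum_mul_left]
    refine tsum_congr fun s' => ?_
    rw [← hface (s' τ)]
    have ein : ∑' t' : Site (d + 1), (if t' κ % (Lc : ℤ) = (Lc : ℤ) - 1 then unitS sf sm (SpureRecAt d Lc (toSite r) cE cVH cΛ j) κ t' s s' f (Sum.inl τ) else 0) =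
        -((sf * sm)⁻¹ * legScale sf⁻¹ sm⁻¹ f * sf⁻¹ * sgnF f) * ∑' t' : Site (d + 1), ((Lc : ℝ)⁻¹ + (Φ (t' κ + 1) - Φ (t' κ))) * SpureRecAt d Lc (toSite r) cE cVH cΛ j κ t' s' s (Sum.inl τ) f := by
      rw [← tsum_mul_left]
      refine tsum_congr fun t' => ?_
      rw [← hface (t' κ)]
      by_cases hc : t' κ % (Lc : ℤ) = (Lc : ℤ) - 1
      · rw [if_pos hc, if_pos hc, eentry, one_mul]
      · rw [if_neg hc, if_neg hc, zero_mul, mul_zero]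
    rw [ein]
    split_ifs <;> ring
  rw [eterm μ ν, eterm ν μ, ← mul_add, hT, mul_zero]

end Summit.QuantumFields.BalabanUV.Beta.GAN24.CurrentSymTower

end

/-!
# Part B (staged module name `GAN24.RespWordsAllLevels`, merged here, never filed separately) — binder row G-an2-4 ∕ (CONV-C), W-slot CT-W, conservation law (C)∕(C)sym AT ALL LEVELS, step (L3c)_j of leaf-06 g52's division
# (`HOME/b2b-balaban-gan24-formalise-leaf-06/g52/C-LEVELS-GE1.md` §17 (W9)) and of this lineage's note `HOME/b2b-balaban-gan24-formalise-leaf-04/g68/EXIT-FACE-CURRENT-TOWER.md`: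
# **THE TWO OUTER-SUMMED SECOND-RESPONSE WORDS OF THE DRESSED LEVEL-`j` SOURCE CANCEL, FOR EVERY `j`** — 40 `RespWordsLevelZero.respWords_add_swap_eq_zero` with `0 ↦ j`:
# for every bond `c`, `Σ'_{u′} FF[dM (K2OfK X̃♮_j Lc S♮_j M μ c) Lc S♮_j M ν u′] + Σ'_{u′} FF[dM (K2OfK X̃♮_j Lc S♮_j M ν c) Lc S♮_j M μ u′] = 0`, `S♮_j = unitS s_f s_m (SpureRecAt … j)`.

NOT IN PRINT; OUR BOOKKEEPING ([folklore] tsum bookkeeping BY NAME over this lineage's 38 `RespWordCellForm.tsum_respWord_eq_cell` (every `j`), 39 `RespChargeSym.respCharge_eq ∕ abs_faceSource_le`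
(every `j`), 37 `RespInnerBondKernel.decays_gaugeStencil`, this gen's (A)-tower `CurrentSymTower.faceSource_unitS_SpureRecAt_add_swap_eq_zero`, 22 `ExchangeSlotResum.face_weight_periodic`, an2's
`SpineRecursiveW.locStencil_SpureRecAt ∕ SpureRecAt_translate`, 26 `VHWordsZeroBorder.unitS_translate_block`; G-an2-4 formalisation swarm, leaf prover `b2b-balaban-gan24-formalise-leaf-04`, gen 69).
HONEST FRAMING (cell contract, verbatim): «discharging `BetaPertH` makes Bałaban's UV stability UNCONDITIONAL — a real constructive-QFT result; it is NOT the continuum limit and NOT the Clay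
problem.»  HONEST DEPENDENCY (verbatim): «continuum YM on T⁴ ⇐ BetaPertH ∧ nine spine estimates (0/9 proved); BetaPertH ⇐ (D1) ∧ (D4) ∧ CAP+tail; G-an2-4 gates asym, D1 and NE2/3/4.»

WHY.  At level `0` (39∕40) the symmetrised face source of `S♮_0` vanished on FIELD first legs (35) and was a block constant `V_{ρ′}` on multiplier first legs, killed at the end by the cell
identity `Σ_{r∈box} 𝟙f(r_κ)·Φ_κ(r) = 0`.  The (A)-tower (`CurrentSymTower`) says more, at every level: the symmetrised face source of `S♮_j` vanishes at EVERY first leg — so the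
symmetrised column charges of the gauge-differentiated inverse are ZERO (`respCharge_add_swap_eq_zero`), and 38's cell form of the two words adds up to `0` with no cell identity at all.

WHAT ([folklore]; generic `d`; in-block root, `1 ≤ Lc`, EVERY `j`, all units and colour constants; 0 `def`, 0 cited facts, 0 `def … : Prop`, 0 sorry): §1 **`respCharge_add_swap_eq_zero`**
(`chg^{𝒦_μ}_ν(g,t) + chg^{𝒦_ν}_μ(g,t) = 0`, every row `(t, g)`, every `j`); §2 `cell_pairing_add_swap_eq_zero'` (finite algebra); §3 **`respWords_add_swap_eq_zero`** (the headline, every `j`,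
ANY block-covariant multiplier vertex family `M`).  Asserts NO value of Bałaban's tables; discharges NOTHING of (C)sym ∕ (Q-D) ∕ (Q-D-rate) ∕ «T2Shape» ∕ «T2Drift» ∕ (hW, hWall); NEVER
«G-an2-4 closed» as (CONV-C); NOT D1, NOT `BetaPertH`, NOT continuum, NOT Clay.  2026-08-23; no existing file touched.
-/

noncomputable section

open Finset
open scoped BigOperators
open Literature.MathematicalPhysics.QuantumFieldTheory
open Literature.MathematicalPhysics.QuantumFieldTheory.Balaban1983to89
open Literature.MathematicalPhysics.QuantumFieldTheory.Balaban1983to89.Beta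
open AffineAveraging (Site box toSite)
open B12Sec2to5 (l1 l1_nonneg)
open ExpKernelCalculus (MKer comp Decays BiLoc VertexFamily Zl Zl_nonneg shiftK summable_exp_shift summable_exp_shift' tsum_exp_shift)
open OneStepResolventKernel (Fib LocStencil decays_mono)
open OneStepKernelFamily (KInvStep decays_KInvStep)
open SecondOrderResponse (dM K2OfK)
open Summit.QuantumFields.BalabanUV.Beta.HessKerDressedUnits (unitK unitS decays_unitK locStencil_unitS)
open Summit.QuantumFields.BalabanUV.Beta.AxialDressingRooted (coDressKBmAt decays_coDressKBmAt)
open Summit.QuantumFields.BalabanUV.Beta.SpineRooted (SpureRecAt locStencil_SpureRecAt SpureRecAt_translate)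
open Summit.QuantumFields.BalabanUV.Beta.GAN24.ExchangeSlotResum (face_weight_periodic)
open Summit.QuantumFields.BalabanUV.Beta.GAN24.VHWordsZeroBorder (unitS_translate_block)
open Summit.QuantumFields.BalabanUV.Beta.GAN24.RespWordCellForm (tsum_respWord_eq_cell)
open Summit.QuantumFields.BalabanUV.Beta.GAN24.RespChargeSym (respCharge_eq abs_faceSource_le)
open Summit.QuantumFields.BalabanUV.Beta.GAN24.CurrentSymTower (faceSource_unitS_SpureRecAt_add_swap_eq_zero)

namespace Summit.QuantumFields.BalabanUV.Beta.GAN24.RespWordsAllLevels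

variable {d : ℕ} {Lc : ℕ} [NeZero Lc] {r : Fin (d + 1) → ℕ}

/-! ## §1 The symmetrised column charges vanish at every level -/

/-- [folklore] **THE `(μ ↔ ν)`-SYMMETRISED COLUMN CHARGES OF THE GAUGE-DIFFERENTIATED INVERSE VANISH AT EVERY LEVEL** (in-block root, `1 ≤ Lc`, all units and colour constants, every row
`(t, g)`): `chg^{𝒦_μ}_ν(g,t) + chg^{𝒦_ν}_μ(g,t) = 0` — 39's `respCharge_eq` twice and the (A)-tower at every first leg. -/
theorem respCharge_add_swap_eq_zero (hLc : 1 ≤ Lc) (hr : r ∈ box (d + 1) Lc) (sf sm cE cVH cΛ : ℝ) (j : ℕ) (μ ν : Fin (d + 1)) (t : Site (d + 1)) (g : Fib d) :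
    (-(∑' s' : Site (d + 1), ∑ b : Fib d,
        comp (unitK sf sm (coDressKBmAt (toSite r) Lc (KInvStep (d := d) Lc j)))
          (fun x z a b => ((Lc : ℝ) * (sm * sf)) * ((((Lc ^ (j + 1) : ℕ) : ℝ)) ^ (d + 1 + 1))⁻¹ *
            ∑' t : Site (d + 1), (if t μ % (Lc : ℤ) = (Lc : ℤ) - 1 then unitS sf sm (SpureRecAt d Lc (toSite r) cE cVH cΛ j) μ t x z a b else 0)) t s' g b *
          Sum.elim (fun a : Fin (d + 1) => if s' a % (Lc : ℤ) = (Lc : ℤ) - 1 then ((Lc : ℝ) * (sm * sf)) *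
            (if a = ν then ((((Lc ^ (j + 1) : ℕ) : ℝ)) ^ (d + 1 + 1))⁻¹ else 0) else 0) (fun _ => (0 : ℝ)) b)) +
      -(∑' s' : Site (d + 1), ∑ b : Fib d,
        comp (unitK sf sm (coDressKBmAt (toSite r) Lc (KInvStep (d := d) Lc j)))
          (fun x z a b => ((Lc : ℝ) * (sm * sf)) * ((((Lc ^ (j + 1) : ℕ) : ℝ)) ^ (d + 1 + 1))⁻¹ *
            ∑' t : Site (d + 1), (if t ν % (Lc : ℤ) = (Lc : ℤ) - 1 then unitS sf sm (SpureRecAt d Lc (toSite r) cE cVH cΛ j) ν t x z a b else 0)) t s' g b *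
          Sum.elim (fun a : Fin (d + 1) => if s' a % (Lc : ℤ) = (Lc : ℤ) - 1 then ((Lc : ℝ) * (sm * sf)) *
            (if a = μ then ((((Lc ^ (j + 1) : ℕ) : ℝ)) ^ (d + 1 + 1))⁻¹ else 0) else 0) (fun _ => (0 : ℝ)) b) = 0 := by
  classical
  obtain ⟨Cs₀, δs₀, hδs₀, hS₀⟩ := locStencil_SpureRecAt (d := d) (Lc := Lc) hLc hr cE cVH cΛ j
  have hS := locStencil_unitS (sf := sf) (sm := sm) hS₀
  rw [respCharge_eq hLc hr sf sm j hS hδs₀ μ ν t g, respCharge_eq hLc hr sf sm j hS hδs₀ ν μ t g, ← neg_add, ← mul_add, neg_eq_zero]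
  -- summability of the two `s`-families (decaying kernel × bounded source), as in 39
  obtain ⟨δ, C, hδ, hC, hXd⟩ := decays_coDressKBmAt hLc hr (decays_KInvStep (d := d) (Lc := Lc) j)
  have hXu := decays_unitK (sf := sf) (sm := sm) hXd
  have hsum : ∀ (κ τ : Fin (d + 1)), Summable fun s : Site (d + 1) => ∑ f : Fib d, unitK sf sm (coDressKBmAt (toSite r) Lc (KInvStep (d := d) Lc j)) t s g f *
      ∑' s' : Site (d + 1), (if s' τ % (Lc : ℤ) = (Lc : ℤ) - 1 then
        (((Lc : ℝ) * (sm * sf)) * ((((Lc ^ (j + 1) : ℕ) : ℝ)) ^ (d + 1 + 1))⁻¹ *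
          ∑' t' : Site (d + 1), (if t' κ % (Lc : ℤ) = (Lc : ℤ) - 1 then unitS sf sm (SpureRecAt d Lc (toSite r) cE cVH cΛ j) κ t' s s' f (Sum.inl τ) else 0)) else 0) := by
    intro κ τ
    obtain ⟨CG, hGκ⟩ : ∃ CG : ℝ, Decays (fun x z a b => ((Lc : ℝ) * (sm * sf)) * ((((Lc ^ (j + 1) : ℕ) : ℝ)) ^ (d + 1 + 1))⁻¹ *
        ∑' t : Site (d + 1), (if t κ % (Lc : ℤ) = (Lc : ℤ) - 1 then unitS sf sm (SpureRecAt d Lc (toSite r) cE cVH cΛ j) κ t x z a b else 0)) CG (δs₀ / 2) :=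
      ⟨_, RespInnerBondKernel.decays_gaugeStencil (Lc := Lc) hS hδs₀ sf sm j κ⟩
    have hCG : 0 ≤ CG := hGκ.nonneg (Sum.inl 0)
    refine summable_sum fun f _ => ?_
    refine Summable.of_norm_bounded (((summable_exp_shift hδ t).mul_left (max |sf| |sm| * C * max |sf| |sm|)).mul_right (CG * Zl (d + 1) (δs₀ / 2))) (fun s => ?_)
    rw [Real.norm_eq_abs, abs_mul]
    exact mul_le_mul (hXu t s g f) (abs_faceSource_le Lc hGκ (half_pos hδs₀) τ s f) (abs_nonneg _) (by positivity)
  rw [← (hsum μ ν).tsum_add (hsum ν μ)]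
  refine mul_eq_zero_of_right _ ((tsum_congr fun s => ?_).trans tsum_zero)
  rw [← Finset.sum_add_distrib]
  refine Finset.sum_eq_zero fun f _ => ?_
  rw [← mul_add, faceSource_unitS_SpureRecAt_add_swap_eq_zero hr sf sm cE cVH cΛ _ j μ ν s f, mul_zero]

/-! ## §2 Finite algebra -/

omit [NeZero Lc] in
/-- [folklore] Two cell pairings whose row charges `Q₁, Q₂` sum to zero add up to `0` (40's assembly shape with `V = 0`). -/
theorem cell_pairing_add_swap_eq_zero' {Q₁ Q₂ : Fib d → Site (d + 1) → ℝ} {Φ : Fin (d + 1) → Site (d + 1) → ℝ} {Ψ : Fin (d + 1) → ℝ}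
    (hQ : ∀ (t : Site (d + 1)) (g : Fib d), Q₁ g t + Q₂ g t = 0) :
    ((∑ r' ∈ box (d + 1) Lc, ∑ κ : Fin (d + 1), Q₁ (Sum.inl κ) (toSite r') * Φ κ (toSite r')) + ∑ ρ' : Fin (d + 1), Q₁ (Sum.inr ρ') 0 * Ψ ρ') +
      ((∑ r' ∈ box (d + 1) Lc, ∑ κ : Fin (d + 1), Q₂ (Sum.inl κ) (toSite r') * Φ κ (toSite r')) + ∑ ρ' : Fin (d + 1), Q₂ (Sum.inr ρ') 0 * Ψ ρ') = 0 := by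
  have hF : (∑ r' ∈ box (d + 1) Lc, ∑ κ : Fin (d + 1), Q₁ (Sum.inl κ) (toSite r') * Φ κ (toSite r')) +
      ∑ r' ∈ box (d + 1) Lc, ∑ κ : Fin (d + 1), Q₂ (Sum.inl κ) (toSite r') * Φ κ (toSite r') = 0 := by
    rw [← Finset.sum_add_distrib]
    refine Finset.sum_eq_zero fun r' _ => ?_
    rw [← Finset.sum_add_distrib]
    refine Finset.sum_eq_zero fun κ _ => ?_
    rw [← add_mul, hQ (toSite r') (Sum.inl κ), zero_mul]
  have hM : (∑ ρ' : Fin (d + 1), Q₁ (Sum.inr ρ') 0 * Ψ ρ') + ∑ ρ' : Fin (d + 1), Q₂ (Sum.inr ρ') 0 * Ψ ρ' = 0 := by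
    rw [← Finset.sum_add_distrib]
    refine Finset.sum_eq_zero fun ρ' _ => ?_
    rw [← add_mul, hQ 0 (Sum.inr ρ'), zero_mul]
  calc _ = ((∑ r' ∈ box (d + 1) Lc, ∑ κ : Fin (d + 1), Q₁ (Sum.inl κ) (toSite r') * Φ κ (toSite r')) +
        ∑ r' ∈ box (d + 1) Lc, ∑ κ : Fin (d + 1), Q₂ (Sum.inl κ) (toSite r') * Φ κ (toSite r')) +
      ((∑ ρ' : Fin (d + 1), Q₁ (Sum.inr ρ') 0 * Ψ ρ') + ∑ ρ' : Fin (d + 1), Q₂ (Sum.inr ρ') 0 * Ψ ρ') := by ring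
    _ = 0 := by rw [hF, hM, add_zero]

/-! ## §3 The words cancel at every level -/

section Words

variable {M : Fin (d + 1) → Site (d + 1) → MKer (d + 1) (Fib d)} {CM δM : ℝ}

/-- [folklore] **THE TWO OUTER-SUMMED SECOND-RESPONSE WORDS OF THE DRESSED LEVEL-`j` SOURCE CANCEL, FOR EVERY `j`** (in-block root, `1 ≤ Lc`, all units and colour constants, ANY
multiplier vertex family `M` at a positive rate that is block-covariant; every axis pattern `(μ,ν;α,β)`, every bond `c`): with `X̃♮_j = unitK s_f s_m (coDressKBmAt ρ Lc (KInvStep Lc j))`,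
`S♮_j = unitS s_f s_m (SpureRecAt … j)`, `FF[V] = Σ'_{(y,w)} 𝟙f(y_α)𝟙f(w_β)·V y w (inl α)(inl β)`:
`Σ'_{u′} FF[dM (K2OfK X̃♮_j Lc S♮_j M μ c) Lc S♮_j M ν u′] + Σ'_{u′} FF[dM (K2OfK X̃♮_j Lc S♮_j M ν c) Lc S♮_j M μ u′] = 0`. -/
theorem respWords_add_swap_eq_zero (hLc : 1 ≤ Lc) (hr : r ∈ box (d + 1) Lc) (sf sm cE cVH cΛ : ℝ) (j : ℕ)
    (hM : VertexFamily M Lc CM δM) (hδM : 0 < δM) (hMcov : ∀ (ρ' : Fin (d + 1)) (w t : Site (d + 1)), M ρ' (w + t) = shiftK (-((Lc : ℤ) • t)) (M ρ' w))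
    (μ ν α β : Fin (d + 1)) (c : Site (d + 1)) :
    (∑' u' : Site (d + 1), ∑' yw : Site (d + 1) × Site (d + 1),
        (if yw.1 α % (Lc : ℤ) = (Lc : ℤ) - 1 then (1 : ℝ) else 0) * (if yw.2 β % (Lc : ℤ) = (Lc : ℤ) - 1 then (1 : ℝ) else 0) *
          dM (K2OfK (unitK sf sm (coDressKBmAt (toSite r) Lc (KInvStep (d := d) Lc j))) Lc (unitS sf sm (SpureRecAt d Lc (toSite r) cE cVH cΛ j)) M μ c) Lc
            (unitS sf sm (SpureRecAt d Lc (toSite r) cE cVH cΛ j)) M ν u' yw.1 yw.2 (Sum.inl α) (Sum.inl β)) +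
      ∑' u' : Site (d + 1), ∑' yw : Site (d + 1) × Site (d + 1),
        (if yw.1 α % (Lc : ℤ) = (Lc : ℤ) - 1 then (1 : ℝ) else 0) * (if yw.2 β % (Lc : ℤ) = (Lc : ℤ) - 1 then (1 : ℝ) else 0) *
          dM (K2OfK (unitK sf sm (coDressKBmAt (toSite r) Lc (KInvStep (d := d) Lc j))) Lc (unitS sf sm (SpureRecAt d Lc (toSite r) cE cVH cΛ j)) M ν c) Lc
            (unitS sf sm (SpureRecAt d Lc (toSite r) cE cVH cΛ j)) M μ u' yw.1 yw.2 (Sum.inl α) (Sum.inl β) = 0 := by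
  classical
  obtain ⟨Cs₀, δs₀, hδs₀, hS₀⟩ := locStencil_SpureRecAt (d := d) (Lc := Lc) hLc hr cE cVH cΛ j
  have hS := locStencil_unitS (sf := sf) (sm := sm) hS₀
  have hScov := unitS_translate_block sf sm (SpureRecAt_translate (d := d) (Lc := Lc) (toSite r) hLc cE cVH cΛ j)
  have h₁ : ∀ y : Site (d + 1), |(if y α % (Lc : ℤ) = (Lc : ℤ) - 1 then (1 : ℝ) else 0)| ≤ 1 := fun y => by split_ifs <;> simp
  have h₂ : ∀ w : Site (d + 1), |(if w β % (Lc : ℤ) = (Lc : ℤ) - 1 then (1 : ℝ) else 0)| ≤ 1 := fun w => by split_ifs <;> simp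
  have hρ₁ : ∀ y s : Site (d + 1), (if (y + (Lc : ℤ) • s) α % (Lc : ℤ) = (Lc : ℤ) - 1 then (1 : ℝ) else 0) = (if y α % (Lc : ℤ) = (Lc : ℤ) - 1 then (1 : ℝ) else 0) :=
    fun y s => face_weight_periodic Lc α y s
  have hρ₂ : ∀ w s : Site (d + 1), (if (w + (Lc : ℤ) • s) β % (Lc : ℤ) = (Lc : ℤ) - 1 then (1 : ℝ) else 0) = (if w β % (Lc : ℤ) = (Lc : ℤ) - 1 then (1 : ℝ) else 0) :=
    fun w s => face_weight_periodic Lc β w s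
  rw [tsum_respWord_eq_cell hLc hr sf sm j hS hδs₀ hScov hM hδM hMcov h₁ h₂ hρ₁ hρ₂ μ ν (Sum.inl α) (Sum.inl β) c,
    tsum_respWord_eq_cell hLc hr sf sm j hS hδs₀ hScov hM hδM hMcov h₁ h₂ hρ₁ hρ₂ ν μ (Sum.inl α) (Sum.inl β) c]
  exact cell_pairing_add_swap_eq_zero' (Lc := Lc)
    (Q₁ := fun g t => -(∑' s' : Site (d + 1), ∑ b : Fib d,
        comp (unitK sf sm (coDressKBmAt (toSite r) Lc (KInvStep (d := d) Lc j)))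
          (fun x z a b => ((Lc : ℝ) * (sm * sf)) * ((((Lc ^ (j + 1) : ℕ) : ℝ)) ^ (d + 1 + 1))⁻¹ *
            ∑' t : Site (d + 1), (if t μ % (Lc : ℤ) = (Lc : ℤ) - 1 then unitS sf sm (SpureRecAt d Lc (toSite r) cE cVH cΛ j) μ t x z a b else 0)) t s' g b *
          Sum.elim (fun a : Fin (d + 1) => if s' a % (Lc : ℤ) = (Lc : ℤ) - 1 then ((Lc : ℝ) * (sm * sf)) *
            (if a = ν then ((((Lc ^ (j + 1) : ℕ) : ℝ)) ^ (d + 1 + 1))⁻¹ else 0) else 0) (fun _ => (0 : ℝ)) b))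
    (Q₂ := fun g t => -(∑' s' : Site (d + 1), ∑ b : Fib d,
        comp (unitK sf sm (coDressKBmAt (toSite r) Lc (KInvStep (d := d) Lc j)))
          (fun x z a b => ((Lc : ℝ) * (sm * sf)) * ((((Lc ^ (j + 1) : ℕ) : ℝ)) ^ (d + 1 + 1))⁻¹ *
            ∑' t : Site (d + 1), (if t ν % (Lc : ℤ) = (Lc : ℤ) - 1 then unitS sf sm (SpureRecAt d Lc (toSite r) cE cVH cΛ j) ν t x z a b else 0)) t s' g b *
          Sum.elim (fun a : Fin (d + 1) => if s' a % (Lc : ℤ) = (Lc : ℤ) - 1 then ((Lc : ℝ) * (sm * sf)) *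
            (if a = μ then ((((Lc ^ (j + 1) : ℕ) : ℝ)) ^ (d + 1 + 1))⁻¹ else 0) else 0) (fun _ => (0 : ℝ)) b))
    (Φ := fun κ t => ∑' yw : Site (d + 1) × Site (d + 1), (if yw.1 α % (Lc : ℤ) = (Lc : ℤ) - 1 then (1 : ℝ) else 0) * (if yw.2 β % (Lc : ℤ) = (Lc : ℤ) - 1 then (1 : ℝ) else 0) *
        unitS sf sm (SpureRecAt d Lc (toSite r) cE cVH cΛ j) κ t yw.1 yw.2 (Sum.inl α) (Sum.inl β))
    (Ψ := fun ρ' => ∑' yw : Site (d + 1) × Site (d + 1), (if yw.1 α % (Lc : ℤ) = (Lc : ℤ) - 1 then (1 : ℝ) else 0) * (if yw.2 β % (Lc : ℤ) = (Lc : ℤ) - 1 then (1 : ℝ) else 0) *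
        M ρ' 0 yw.1 yw.2 (Sum.inl α) (Sum.inl β))
    (fun t g => respCharge_add_swap_eq_zero hLc hr sf sm cE cVH cΛ j μ ν t g)

end Words

end Summit.QuantumFields.BalabanUV.Beta.GAN24.RespWordsAllLevels

end
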